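import Summits.QuantumFields.QCD.Theorems.SpectralDefectExtinctionWegnerEstimateCoareaHellmannFeynman

/-!
# Bridge lemma B toward stub `coareaWegner` of line `Sketch` (skeleton "ResolventCell", gen 2) for
crux `SpectralDefectExtinction.WegnerEstimate` (item stmt-QuantumFields-8966):
one-link circles move `Γ₅ D_W` inside a rank-24 pencil (the `circleZeroCount` shape)

Rotating ONE link `e = (z, μ)` of a gauge field `W` along a curve `c : ℝ → SU(3)` whose matrix is a
trigonometric polynomial of degree one, `c(t) = δ₀ + cos t · δ₁ + sin t · δ₂` (every closed
one-parameter circle `t ↦ exp(tX)`, `X` in the explicit `su(3)` basis of the registered signatures,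
is of this form), changes the Hermitian Wilson operator `H = Γ₅ D_W(·, m₀, 1)` only in the two
`12 × 12` blocks `(z, z + μ̂)` (forward hop, linear in `W(e) c(t)`) and `(z + μ̂, z)` (backward hop,
linear in `(W(e) c(t))† `), so that for every fixed matrix `S` (e.g. `S = E·1`, a spectral parameter)

  `det (H(W[e ↦ W(e) c(t)]) − S) = det (A + B (Δ₀ + cos t · Δ₁ + sin t · Δ₂) C)`

for matrices `A : N × N`, `B : N × 24`, `C : 24 × N`, `Δᵢ : 24 × 24` independent of `t`
(`N = 12 L⁴`, everything reindexed to `Fin _`; `coareaWegner_oneLinkCircle_detShape`).  This is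
verbatim the shape of hypothesis `hzero` (= the landed `stub_circleZeroCount`) of `stub_coareaWegner`
with `r = 24`: along every one-link circle, `t ↦ det (H − E)` either vanishes identically or has at
most `48` zeros in `[0, 2π)`, independently of `L` — the crossing count fed to the Crofton slicing
inequality in the paper proof (Lines/Sketch.md §gen 2).

On the way (all `theorem`s, general unitary colour representation `ρ`, all `L ≥ 1`, real `m`, `r`):
* `coareaWegner_gammaFiveWilson_decomp` — the MATRIX hop decomposition
  `Γ₅ D_W = diag((m + 4r) ε) + F + Fᴴ`, `F` the forward-hop matrix (entrywise γ₅-hermiticity);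
* `coareaWegner_fwdMatrix_eq_edgeSum` — `F = Σ_e F_e(ρ(U e))`, each `F_e` linear in the link matrix;
* `coareaWegner_edgeSum_update` — replacing one link changes one term of such an edge sum;
* `coareaWegner_block_factor` — `F_e(M) + F_e(M)ᴴ = B_q · diag(k, kᴴ) · C_q` with explicit
  coordinate-inclusion matrices `B_q : N × (12 ⊕ 12)`, `C_q : (12 ⊕ 12) × N`;
* `coareaWegner_det_reindex_shape` — reindexing to `Fin N`, `Fin 24` preserves the determinant.
-/

noncomputable section

namespace Summit.QuantumFields.QCD.Cruxes.WegnerEstimate.ResolventCell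

open MeasureTheory
open scoped Matrix BigOperators
open Literature.MathematicalPhysics.QuantumLattice Literature.MathematicalPhysics.QuantumFieldTheory
  Literature.Probability.LatticeModels
open Matrix
open scoped ComplexOrder

section General

variable {L N : ℕ} {G : Type*} [Group G] (ρ : G →* Matrix (Fin N) (Fin N) ℂ)

/-- Algebraic skeleton of the entrywise matrix decomposition
`ε_p D_{pq} = (mass) + (−c) Σ_μ F + conj ((−c) Σ_μ F')`. -/
theorem coareaWegner_entry_aux2 {ι : Type*} [Fintype ι] (a M M' c : ℂ) (f g F F'' : ι → ℂ)
    (hM : a * M = M') (hc : star c = c) (hf : ∀ i, a * f i = F i)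
    (hg : ∀ i, a * g i = star (F'' i)) :
    a * (M - c * ∑ i, (f i + g i)) = M' + (-c) * ∑ i, F i + star ((-c) * ∑ i, F'' i) := by
  rw [star_mul', star_neg, hc, star_sum, ← hM, mul_sub, Finset.mul_sum, Finset.mul_sum,
    Finset.mul_sum, Finset.mul_sum, sub_eq_add_neg, add_assoc, ← Finset.sum_add_distrib,
    ← Finset.sum_neg_distrib]
  congr 1
  refine Finset.sum_congr rfl fun i _ => ?_
  rw [← hf, ← hg]
  ring

/-- **Matrix hop decomposition of `Γ₅ D_W`.**  For a unitary colour representation `ρ`, any gauge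
field `U` and real `m`, `r`:  `Γ₅ D_W = diag((m + 4r) ε_p) + F + Fᴴ`, where
`F_{pq} = −½ Σ_μ [x(q) = x(p) + μ̂] ε_{α(p)} (r − γ_μ)_{α(p) α(q)} ρ(U(x(p), μ))_{a(p) a(q)}` is the
forward-hop matrix and `ε = (1, 1, −1, −1)`; the backward hops are `Fᴴ` by entrywise
γ₅-hermiticity.  All torus sides `L ≥ 1`. -/
theorem coareaWegner_gammaFiveWilson_decomp [NeZero L]
    (hρ : ∀ g, ρ g ∈ Matrix.unitaryGroup (Fin N) ℂ) (U : GaugeConfig 4 L G) (m r : ℝ) :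
    spinorLift gammaFive * wilsonDirac ρ U m r =
      diagonal (fun p : TorusSite 4 L × Fin N × Fin 4 =>
          ((m + 4 * r : ℝ) : ℂ) * (![1, 1, -1, -1] : Fin 4 → ℂ) p.2.2) +
        Matrix.of (fun p q : TorusSite 4 L × Fin N × Fin 4 => -(1 / 2 : ℂ) * ∑ μ : Fin 4,
          (if q.1 = Literature.MathematicalPhysics.QuantumFieldTheory.Site.shift p.1 μ then
            (![1, 1, -1, -1] : Fin 4 → ℂ) p.2.2 *
              ((r : ℂ) • (1 : Matrix (Fin 4) (Fin 4) ℂ) - euclideanGamma μ) p.2.2 q.2.2 *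
              ρ (U (p.1, μ)) p.2.1 q.2.1 else 0)) +
        (Matrix.of (fun p q : TorusSite 4 L × Fin N × Fin 4 => -(1 / 2 : ℂ) * ∑ μ : Fin 4,
          (if q.1 = Literature.MathematicalPhysics.QuantumFieldTheory.Site.shift p.1 μ then
            (![1, 1, -1, -1] : Fin 4 → ℂ) p.2.2 *
              ((r : ℂ) • (1 : Matrix (Fin 4) (Fin 4) ℂ) - euclideanGamma μ) p.2.2 q.2.2 *
              ρ (U (p.1, μ)) p.2.1 q.2.1 else 0)))ᴴ := by
  rw [spinorLift_gammaFive_eq_diagonal]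
  ext p q
  rw [diagonal_mul, Matrix.add_apply, Matrix.add_apply, conjTranspose_apply, diagonal_apply, of_apply,
    of_apply]
  simp only [wilsonDirac, of_apply]
  refine coareaWegner_entry_aux2 _ _ _ _ _ _ _ _ ?_ (by simp) (fun ν => ?_) (fun ν => ?_)
  · split_ifs <;> ring
  · simp only [mul_ite, mul_zero, mul_assoc]
  · split_ifs with hc
    · rw [star_mul', star_mul', coareaWegner_star_sign, unitaryRep_star_apply ρ hρ,
        ← gammaFiveSign_mul_add_euclideanGamma_mul_gammaFiveSign r ν p.2.2 q.2.2]
      have h1 := gammaFiveSign_mul_self q.2.2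
      have : ∀ a b x y : ℂ, b * b = 1 → a * (x * y) = b * (a * x * b) * y := by
        intro a b x y hb
        linear_combination (-(a * x * y)) * hb
      exact this _ _ _ _ h1
    · rw [mul_zero, star_zero]

/-- **The forward-hop matrix as a sum over edges**, each term depending on the gauge field only
through one link and linearly:  `F = Σ_{e = (x, μ)} F_e(ρ(U e))`,
`F_e(M)_{pq} = [x(p) = x, x(q) = x + μ̂] · (−½) ε_{α(p)} (r − γ_μ)_{α(p) α(q)} M_{a(p) a(q)}`. -/
theorem coareaWegner_fwdMatrix_eq_edgeSum [NeZero L] (U : GaugeConfig 4 L G) (r : ℝ) :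
    Matrix.of (fun p q : TorusSite 4 L × Fin N × Fin 4 => -(1 / 2 : ℂ) * ∑ μ : Fin 4,
        (if q.1 = Literature.MathematicalPhysics.QuantumFieldTheory.Site.shift p.1 μ then
          (![1, 1, -1, -1] : Fin 4 → ℂ) p.2.2 *
            ((r : ℂ) • (1 : Matrix (Fin 4) (Fin 4) ℂ) - euclideanGamma μ) p.2.2 q.2.2 *
            ρ (U (p.1, μ)) p.2.1 q.2.1 else 0)) =
      ∑ e : Edge 4 L, Matrix.of (fun p q : TorusSite 4 L × Fin N × Fin 4 =>
        if p.1 = e.1 ∧ q.1 = Literature.MathematicalPhysics.QuantumFieldTheory.Site.shift e.1 e.2 then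
          -(1 / 2 : ℂ) * ((![1, 1, -1, -1] : Fin 4 → ℂ) p.2.2 *
            ((r : ℂ) • (1 : Matrix (Fin 4) (Fin 4) ℂ) - euclideanGamma e.2) p.2.2 q.2.2 *
            ρ (U e) p.2.1 q.2.1) else 0) := by
  ext p q
  rw [Matrix.sum_apply]
  simp only [of_apply]
  rw [Fintype.sum_prod_type]
  dsimp only
  rw [Finset.sum_eq_single p.1]
  · simp only [true_and]
    rw [Finset.mul_sum]
    refine Finset.sum_congr rfl fun ν _ => ?_
    split_ifs <;> ring
  · intro x _ hx
    refine Finset.sum_eq_zero fun ν _ => ?_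
    rw [if_neg]
    rintro ⟨h, _⟩
    exact hx h.symm
  · intro h
    exact absurd (Finset.mem_univ _) h

omit [Group G] in
/-- Replacing the single link `e` changes exactly one term of an edge sum `Σ_{e'} Φ_{e'}(W e')`. -/
theorem coareaWegner_edgeSum_update [NeZero L] {α : Type*} [AddCommMonoid α]
    (Φ : Edge 4 L → G → α) (W : GaugeConfig 4 L G) (e : Edge 4 L) (v : G) :
    ∑ e', Φ e' (Function.update W e v e') = Φ e v + ∑ e' ∈ Finset.univ \ {e}, Φ e' (W e') := by
  have : (fun e' => Φ e' (Function.update W e v e')) =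
      Function.update (fun e' => Φ e' (W e')) e (Φ e v) := by
    funext e'
    exact Function.apply_update (fun e' u => Φ e' u) W e v e'
  rw [this, Finset.sum_update_of_mem (Finset.mem_univ _)]

/-- **Rank-`2·(4N)` factorization of a one-link perturbation.**  A matrix supported on the site block
`(z, w)` with colour–spin block `k`, plus its conjugate transpose (supported on `(w, z)`), factors as
`B_q · diag(k, kᴴ) · C_q` through the coordinate inclusions of the `4N + 4N` colour–spin coordinates
at the sites `z`, `w` (`B_q`) and `w`, `z` (`C_q`).  No hypothesis `z ≠ w`. -/
theorem coareaWegner_block_factor (z w : TorusSite 4 L) (k : Matrix (Fin N × Fin 4) (Fin N × Fin 4) ℂ) :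
    Matrix.of (fun p q : TorusSite 4 L × Fin N × Fin 4 => if p.1 = z ∧ q.1 = w then k p.2 q.2 else 0) +
      (Matrix.of (fun p q : TorusSite 4 L × Fin N × Fin 4 =>
        if p.1 = z ∧ q.1 = w then k p.2 q.2 else 0))ᴴ =
    Matrix.of (fun (p : TorusSite 4 L × Fin N × Fin 4) (s : (Fin N × Fin 4) ⊕ (Fin N × Fin 4)) =>
        Sum.elim (fun i : Fin N × Fin 4 => if p = (z, i) then (1 : ℂ) else 0)
          (fun i : Fin N × Fin 4 => if p = (w, i) then (1 : ℂ) else 0) s) *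
      Matrix.fromBlocks k 0 0 kᴴ *
      Matrix.of (fun (s : (Fin N × Fin 4) ⊕ (Fin N × Fin 4)) (q : TorusSite 4 L × Fin N × Fin 4) =>
        Sum.elim (fun i : Fin N × Fin 4 => if q = (w, i) then (1 : ℂ) else 0)
          (fun i : Fin N × Fin 4 => if q = (z, i) then (1 : ℂ) else 0) s) := by
  ext p q
  obtain ⟨x, i⟩ := p
  obtain ⟨y, j⟩ := q
  have hB : ∀ (x₀ : TorusSite 4 L) (f : Fin N × Fin 4 → ℂ),
      ∑ l, (if ((x, i) : TorusSite 4 L × Fin N × Fin 4) = (x₀, l) then (1 : ℂ) else 0) * f l =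
        if x = x₀ then f i else 0 := by
    intro x₀ f
    by_cases h : x = x₀
    · subst h
      simp [Prod.mk.injEq]
    · simp [Prod.mk.injEq, h]
  have hC : ∀ (x₀ : TorusSite 4 L) (f : Fin N × Fin 4 → ℂ),
      ∑ l, f l * (if ((y, j) : TorusSite 4 L × Fin N × Fin 4) = (x₀, l) then (1 : ℂ) else 0) =
        if y = x₀ then f j else 0 := by
    intro x₀ f
    by_cases h : y = x₀
    · subst h
      simp [Prod.mk.injEq]
    · simp [Prod.mk.injEq, h]
  have e₁ : (if x = z ∧ y = w then k i j else 0) = if y = w then (if x = z then k i j else 0) else 0 := by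
    by_cases hxz : x = z <;> by_cases hyw : y = w <;> simp [hxz, hyw]
  have e₂ : star (if y = z ∧ x = w then k j i else 0) =
      if y = z then (if x = w then star (k j i) else 0) else 0 := by
    by_cases hyz : y = z <;> by_cases hxw : x = w <;> simp [hyz, hxw]
  simp only [Matrix.add_apply, conjTranspose_apply, of_apply, mul_apply, Fintype.sum_sum_type,
    Sum.elim_inl, Sum.elim_inr, fromBlocks_apply₁₁, fromBlocks_apply₁₂, fromBlocks_apply₂₁,
    fromBlocks_apply₂₂, Matrix.zero_apply, hB, hC, ite_self, add_zero, zero_add]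
  rw [e₁, e₂]

/-- Reindexing a pencil `K + B_q (D₀ + cos t D₁ + sin t D₂) C_q` over arbitrary finite index types
(inner index of cardinality `24`) to `Fin N`, `Fin 24` does not change its determinant. -/
theorem coareaWegner_det_reindex_shape {m o : Type*} [Fintype m] [DecidableEq m] [Fintype o]
    [DecidableEq o] (ho : Fintype.card o = 24) (K : Matrix m m ℂ) (Bq : Matrix m o ℂ)
    (Cq : Matrix o m ℂ) (D₀ D₁ D₂ : Matrix o o ℂ) :
    ∃ (n : ℕ) (A : Matrix (Fin n) (Fin n) ℂ) (B : Matrix (Fin n) (Fin 24) ℂ) (C : Matrix (Fin 24) (Fin n) ℂ)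
      (Δ₀ Δ₁ Δ₂ : Matrix (Fin 24) (Fin 24) ℂ), ∀ t : ℝ,
      (K + Bq * (D₀ + ((Real.cos t : ℝ) : ℂ) • D₁ + ((Real.sin t : ℝ) : ℂ) • D₂) * Cq).det =
        (A + B * (Δ₀ + ((Real.cos t : ℝ) : ℂ) • Δ₁ + ((Real.sin t : ℝ) : ℂ) • Δ₂) * C).det := by
  set eN : m ≃ Fin (Fintype.card m) := Fintype.equivFin m
  set eo : o ≃ Fin 24 := Fintype.equivFinOfCardEq ho
  refine ⟨Fintype.card m, reindex eN eN K, reindex eN eo Bq, reindex eo eN Cq, reindex eo eo D₀,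
    reindex eo eo D₁, reindex eo eo D₂, fun t => ?_⟩
  rw [← Matrix.det_reindex_self eN (K + _)]
  congr 1
  simp only [reindex_apply]
  rw [submatrix_add, Pi.add_apply, Pi.add_apply,
    submatrix_mul _ Cq _ eo.symm _ eo.symm.bijective, submatrix_mul Bq _ _ eo.symm _ eo.symm.bijective,
    submatrix_add, Pi.add_apply, Pi.add_apply, submatrix_add, Pi.add_apply, Pi.add_apply,
    submatrix_smul, Pi.smul_apply, Pi.smul_apply, submatrix_smul, Pi.smul_apply, Pi.smul_apply]

end General

/-- **Bridge lemma B (one-link circles have the `circleZeroCount` shape).**  For the Hermitian Wilson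
operator `H(U) = Γ₅ D_W(U, m₀, 1)` on the four-torus of any side `L ≥ 1`, a gauge field `W`, a link
`e = (z, μ)`, a curve `c : ℝ → SU(3)` whose matrix is a degree-one trigonometric polynomial
`c(t) = δ₀ + cos t · δ₁ + sin t · δ₂`, and any fixed matrix `S`, there are `N` and matrices
`A : N × N`, `B : N × 24`, `C : 24 × N`, `Δ₀, Δ₁, Δ₂ : 24 × 24` with
`det (H(W[e ↦ W(e) c(t)]) − S) = det (A + B (Δ₀ + cos t Δ₁ + sin t Δ₂) C)` for all `t` — the shape of
hypothesis `hzero` of `stub_coareaWegner` (the landed `stub_circleZeroCount`) with `r = 24`. -/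
theorem coareaWegner_oneLinkCircle_detShape {L : ℕ} [NeZero L] (W : GaugeConfig 4 L SU3) (m₀ : ℝ)
    (z : TorusSite 4 L) (μ : Fin 4) (c : ℝ → SU3) (δ₀ δ₁ δ₂ : Matrix (Fin 3) (Fin 3) ℂ)
    (hc : ∀ t, ((c t : SU3) : Matrix (Fin 3) (Fin 3) ℂ) =
      δ₀ + ((Real.cos t : ℝ) : ℂ) • δ₁ + ((Real.sin t : ℝ) : ℂ) • δ₂)
    (S : Matrix (QuarkIdx L) (QuarkIdx L) ℂ) :
    ∃ (N : ℕ) (A : Matrix (Fin N) (Fin N) ℂ) (B : Matrix (Fin N) (Fin 24) ℂ) (C : Matrix (Fin 24) (Fin N) ℂ)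
      (Δ₀ Δ₁ Δ₂ : Matrix (Fin 24) (Fin 24) ℂ), ∀ t : ℝ,
      (spinorLift gammaFive * wilsonDirac (fundamentalRep (Fin 3))
          (Function.update W (z, μ) (W (z, μ) * c t)) m₀ 1 - S).det =
        (A + B * (Δ₀ + ((Real.cos t : ℝ) : ℂ) • Δ₁ + ((Real.sin t : ℝ) : ℂ) • Δ₂) * C).det := by
  -- the `12 × 12` colour–spin hop block of a `3 × 3` colour matrix `M`
  set k : Matrix (Fin 3) (Fin 3) ℂ → Matrix (Fin 3 × Fin 4) (Fin 3 × Fin 4) ℂ := fun M =>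
    Matrix.of fun i j : Fin 3 × Fin 4 => -(1 / 2 : ℂ) * ((![1, 1, -1, -1] : Fin 4 → ℂ) i.2 *
      (((1 : ℝ) : ℂ) • (1 : Matrix (Fin 4) (Fin 4) ℂ) - euclideanGamma μ) i.2 j.2 * M i.1 j.1) with hk
  -- the forward-hop matrix of the edge `e'` with colour matrix `M`
  set Fe : Edge 4 L → Matrix (Fin 3) (Fin 3) ℂ → Matrix (QuarkIdx L) (QuarkIdx L) ℂ := fun e' M =>
    Matrix.of fun p q : QuarkIdx L =>
      if p.1 = e'.1 ∧ q.1 = Literature.MathematicalPhysics.QuantumFieldTheory.Site.shift e'.1 e'.2 then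
        -(1 / 2 : ℂ) * ((![1, 1, -1, -1] : Fin 4 → ℂ) p.2.2 *
          (((1 : ℝ) : ℂ) • (1 : Matrix (Fin 4) (Fin 4) ℂ) - euclideanGamma e'.2) p.2.2 q.2.2 * M p.2.1 q.2.1)
      else 0 with hFe
  -- coordinate inclusions of the two `12`-blocks at `z` and `z + μ̂`
  set Bq : Matrix (QuarkIdx L) ((Fin 3 × Fin 4) ⊕ (Fin 3 × Fin 4)) ℂ :=
    Matrix.of fun (p : QuarkIdx L) (s : (Fin 3 × Fin 4) ⊕ (Fin 3 × Fin 4)) =>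
      Sum.elim (fun i : Fin 3 × Fin 4 => if p = (z, i) then (1 : ℂ) else 0)
        (fun i : Fin 3 × Fin 4 =>
          if p = (Literature.MathematicalPhysics.QuantumFieldTheory.Site.shift z μ, i) then (1 : ℂ) else 0) s
    with hBq
  set Cq : Matrix ((Fin 3 × Fin 4) ⊕ (Fin 3 × Fin 4)) (QuarkIdx L) ℂ :=
    Matrix.of fun (s : (Fin 3 × Fin 4) ⊕ (Fin 3 × Fin 4)) (q : QuarkIdx L) =>
      Sum.elim (fun i : Fin 3 × Fin 4 =>
          if q = (Literature.MathematicalPhysics.QuantumFieldTheory.Site.shift z μ, i) then (1 : ℂ) else 0)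
        (fun i : Fin 3 × Fin 4 => if q = (z, i) then (1 : ℂ) else 0) s
    with hCq
  have hρ : ∀ u : SU3, fundamentalRep (Fin 3) u ∈ Matrix.unitaryGroup (Fin 3) ℂ :=
    fun u => fundamentalRep_mem_unitaryGroup u
  -- (i) matrix hop decomposition, edge by edge
  have h1 : ∀ U : GaugeConfig 4 L SU3,
      spinorLift gammaFive * wilsonDirac (fundamentalRep (Fin 3)) U m₀ 1 =
        diagonal (fun p : QuarkIdx L => ((m₀ + 4 * 1 : ℝ) : ℂ) * (![1, 1, -1, -1] : Fin 4 → ℂ) p.2.2) +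
          (∑ e', Fe e' ((U e' : SU3) : Matrix (Fin 3) (Fin 3) ℂ)) +
          (∑ e', Fe e' ((U e' : SU3) : Matrix (Fin 3) (Fin 3) ℂ))ᴴ := by
    intro U
    rw [coareaWegner_gammaFiveWilson_decomp _ hρ, coareaWegner_fwdMatrix_eq_edgeSum]
    simp only [hFe, fundamentalRep_apply]
  -- (ii) isolate the link `e = (z, μ)`
  have h2 : ∀ v : SU3,
      ∑ e', Fe e' ((Function.update W (z, μ) v e' : SU3) : Matrix (Fin 3) (Fin 3) ℂ) =
        Fe (z, μ) (v : Matrix (Fin 3) (Fin 3) ℂ) +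
          ∑ e' ∈ Finset.univ \ {(z, μ)}, Fe e' ((W e' : SU3) : Matrix (Fin 3) (Fin 3) ℂ) :=
    fun v => coareaWegner_edgeSum_update (fun e' (u : SU3) => Fe e' (u : Matrix (Fin 3) (Fin 3) ℂ)) W (z, μ) v
  -- (iii) the one-link term factors through the two `12`-blocks
  have hFe' : ∀ M, Fe (z, μ) M = Matrix.of (fun p q : QuarkIdx L =>
      if p.1 = z ∧ q.1 = Literature.MathematicalPhysics.QuantumFieldTheory.Site.shift z μ then
        k M p.2 q.2 else 0) := by
    intro M
    simp only [hFe, hk, of_apply]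
  have h3 : ∀ M, Fe (z, μ) M + (Fe (z, μ) M)ᴴ = Bq * Matrix.fromBlocks (k M) 0 0 (k M)ᴴ * Cq := by
    intro M
    rw [hFe']
    exact coareaWegner_block_factor z (Literature.MathematicalPhysics.QuantumFieldTheory.Site.shift z μ) (k M)
  -- (iv) the block is linear in the colour matrix
  have h4 : ∀ (a b : ℂ) (M₀ M₁ M₂ : Matrix (Fin 3) (Fin 3) ℂ),
      k (M₀ + a • M₁ + b • M₂) = k M₀ + a • k M₁ + b • k M₂ := by
    intro a b M₀ M₁ M₂
    ext i j
    simp only [hk, of_apply, Matrix.add_apply, Matrix.smul_apply, smul_eq_mul]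
    ring
  -- abbreviations
  set We : Matrix (Fin 3) (Fin 3) ℂ := ((W (z, μ) : SU3) : Matrix (Fin 3) (Fin 3) ℂ) with hWe
  set R : Matrix (QuarkIdx L) (QuarkIdx L) ℂ :=
    ∑ e' ∈ Finset.univ \ {(z, μ)}, Fe e' ((W e' : SU3) : Matrix (Fin 3) (Fin 3) ℂ) with hR
  set D : Matrix (QuarkIdx L) (QuarkIdx L) ℂ :=
    diagonal (fun p : QuarkIdx L => ((m₀ + 4 * 1 : ℝ) : ℂ) * (![1, 1, -1, -1] : Fin 4 → ℂ) p.2.2) with hD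
  set Δ₀ : Matrix ((Fin 3 × Fin 4) ⊕ (Fin 3 × Fin 4)) ((Fin 3 × Fin 4) ⊕ (Fin 3 × Fin 4)) ℂ :=
    Matrix.fromBlocks (k (We * δ₀)) 0 0 (k (We * δ₀))ᴴ with hΔ₀
  set Δ₁ : Matrix ((Fin 3 × Fin 4) ⊕ (Fin 3 × Fin 4)) ((Fin 3 × Fin 4) ⊕ (Fin 3 × Fin 4)) ℂ :=
    Matrix.fromBlocks (k (We * δ₁)) 0 0 (k (We * δ₁))ᴴ with hΔ₁
  set Δ₂ : Matrix ((Fin 3 × Fin 4) ⊕ (Fin 3 × Fin 4)) ((Fin 3 × Fin 4) ⊕ (Fin 3 × Fin 4)) ℂ :=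
    Matrix.fromBlocks (k (We * δ₂)) 0 0 (k (We * δ₂))ᴴ with hΔ₂
  -- (v) the pencil
  have h5 : ∀ t : ℝ,
      spinorLift gammaFive * wilsonDirac (fundamentalRep (Fin 3))
          (Function.update W (z, μ) (W (z, μ) * c t)) m₀ 1 - S =
        (D + R + Rᴴ - S) + Bq * (Δ₀ + ((Real.cos t : ℝ) : ℂ) • Δ₁ + ((Real.sin t : ℝ) : ℂ) • Δ₂) * Cq := by
    intro t
    have hX : ((W (z, μ) * c t : SU3) : Matrix (Fin 3) (Fin 3) ℂ) =
        We * δ₀ + ((Real.cos t : ℝ) : ℂ) • (We * δ₁) + ((Real.sin t : ℝ) : ℂ) • (We * δ₂) := by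
      rw [Submonoid.coe_mul, hc, Matrix.mul_add, Matrix.mul_add, Matrix.mul_smul, Matrix.mul_smul]
    have hcos : star ((Real.cos t : ℝ) : ℂ) = ((Real.cos t : ℝ) : ℂ) := Complex.conj_ofReal _
    have hsin : star ((Real.sin t : ℝ) : ℂ) = ((Real.sin t : ℝ) : ℂ) := Complex.conj_ofReal _
    have hpen : Fe (z, μ) (We * δ₀ + ((Real.cos t : ℝ) : ℂ) • (We * δ₁) + ((Real.sin t : ℝ) : ℂ) • (We * δ₂)) +
        (Fe (z, μ) (We * δ₀ + ((Real.cos t : ℝ) : ℂ) • (We * δ₁) + ((Real.sin t : ℝ) : ℂ) • (We * δ₂)))ᴴ =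
        Bq * (Δ₀ + ((Real.cos t : ℝ) : ℂ) • Δ₁ + ((Real.sin t : ℝ) : ℂ) • Δ₂) * Cq := by
      rw [h3, h4]
      congr 2
      simp only [hΔ₀, hΔ₁, hΔ₂, fromBlocks_smul, fromBlocks_add, smul_zero, add_zero,
        conjTranspose_add, conjTranspose_smul, hcos, hsin]
    rw [h1, h2, hX, conjTranspose_add, ← hpen]
    abel
  -- (vi) reindex to `Fin N`, `Fin 24`
  obtain ⟨n, A, B, C, E₀, E₁, E₂, hdet⟩ :=
    coareaWegner_det_reindex_shape (by simp) (D + R + Rᴴ - S) Bq Cq Δ₀ Δ₁ Δ₂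
  exact ⟨n, A, B, C, E₀, E₁, E₂, fun t => by rw [h5 t]; exact hdet t⟩

/-- **One-link circles cross spectral level sets at most `48` times** (Bridge B fed into hypothesis
`hzero` of `stub_coareaWegner`, i.e. the landed `stub_circleZeroCount`, with `r = 24`): along a link
curve `c(t) = δ₀ + cos t δ₁ + sin t δ₂` in `SU(3)`, for every fixed matrix `S`, the function
`t ↦ det (Γ₅ D_W(W[e ↦ W(e) c(t)], m₀, 1) − S)` either vanishes identically or has finitely many, and at
most `48`, zeros in `[0, 2π)` — uniformly in the torus side `L`. -/
theorem coareaWegner_oneLinkCircle_crossings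
    (hzero : ∀ (N r : ℕ) (A : Matrix (Fin N) (Fin N) ℂ) (B : Matrix (Fin N) (Fin r) ℂ) (C : Matrix (Fin r) (Fin N) ℂ)
      (δ₀ δ₁ δ₂ : Matrix (Fin r) (Fin r) ℂ),
      (∀ t : ℝ, (A + B * (δ₀ + ((Real.cos t : ℝ) : ℂ) • δ₁ + ((Real.sin t : ℝ) : ℂ) • δ₂) * C).det = 0) ∨
      ({t : ℝ | t ∈ Set.Ico (0 : ℝ) (2 * Real.pi) ∧
          (A + B * (δ₀ + ((Real.cos t : ℝ) : ℂ) • δ₁ + ((Real.sin t : ℝ) : ℂ) • δ₂) * C).det = 0}.Finite ∧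
        {t : ℝ | t ∈ Set.Ico (0 : ℝ) (2 * Real.pi) ∧
          (A + B * (δ₀ + ((Real.cos t : ℝ) : ℂ) • δ₁ + ((Real.sin t : ℝ) : ℂ) • δ₂) * C).det = 0}.ncard ≤ 2 * r))
    {L : ℕ} [NeZero L] (W : GaugeConfig 4 L SU3) (m₀ : ℝ) (z : TorusSite 4 L) (μ : Fin 4) (c : ℝ → SU3)
    (δ₀ δ₁ δ₂ : Matrix (Fin 3) (Fin 3) ℂ)
    (hc : ∀ t, ((c t : SU3) : Matrix (Fin 3) (Fin 3) ℂ) =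
      δ₀ + ((Real.cos t : ℝ) : ℂ) • δ₁ + ((Real.sin t : ℝ) : ℂ) • δ₂)
    (S : Matrix (QuarkIdx L) (QuarkIdx L) ℂ) :
    (∀ t : ℝ, (spinorLift gammaFive * wilsonDirac (fundamentalRep (Fin 3))
        (Function.update W (z, μ) (W (z, μ) * c t)) m₀ 1 - S).det = 0) ∨
      ({t : ℝ | t ∈ Set.Ico (0 : ℝ) (2 * Real.pi) ∧
          (spinorLift gammaFive * wilsonDirac (fundamentalRep (Fin 3))
            (Function.update W (z, μ) (W (z, μ) * c t)) m₀ 1 - S).det = 0}.Finite ∧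
        {t : ℝ | t ∈ Set.Ico (0 : ℝ) (2 * Real.pi) ∧
          (spinorLift gammaFive * wilsonDirac (fundamentalRep (Fin 3))
            (Function.update W (z, μ) (W (z, μ) * c t)) m₀ 1 - S).det = 0}.ncard ≤ 48) := by
  obtain ⟨N, A, B, C, Δ₀, Δ₁, Δ₂, h⟩ := coareaWegner_oneLinkCircle_detShape W m₀ z μ c δ₀ δ₁ δ₂ hc S
  simp only [h]
  rcases hzero N 24 A B C Δ₀ Δ₁ Δ₂ with h0 | ⟨hfin, hcard⟩
  · exact Or.inl h0
  · exact Or.inr ⟨hfin, hcard.trans (by norm_num)⟩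

end Summit.QuantumFields.QCD.Cruxes.WegnerEstimate.ResolventCell

end
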